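import Summits.PneNP.PneNP.Theses.ReslinMediumCover
import Literature.Computability.MetaComplexity.TseitinLiftProofs

/-!
# PneNP / ReslinMediumCover — `τ(G, c) ∘ MAJ₃` is unsatisfiable for odd total charge
(support item stmt-PneNP-19700 `TseitinMajUnsat`)

Route `PneNP/ReslinMediumCover` (draft), support item `TseitinMajUnsat`:
for every graph `G` on `Fin N` and every charge `c` with an odd number of charged vertices, the
lifted Tseitin contradiction `tseitinMaj G c` (`Literature.Computability.MetaComplexity.TseitinLift`)
is unsatisfiable. Proof (Urquhart 1987, Lemma 4.1, one gadget up): an assignment satisfying all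
clauses at `u` satisfies the lifted parity constraint of `u` (`vertexOK_of_eval_tseitinMaj`: the
clause indexed by the set of true star variables is the one it would falsify); summing the
constraints over all vertices counts every lifted edge value twice (`sum_card_filter_edgeVal_eq_zero`,
a fixed-point-free involution), so the total charge is even.

References: A. Urquhart, *Hard examples for resolution*, J. ACM 34 (1987), §4, Lemma 4.1;
S. Jukna, *Boolean Function Complexity* (2012), §18.7; S. K. Bhattacharya, F. Byramji,
A. Chattopadhyay, R. Impagliazzo, STOC 2026, Thm 1.2 (the lifted formula).
-/

namespace Summit.PneNP.PneNP.Theorems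

-- `Summit.PneNP.PneNP` repeats a path component by design (summit = sub-problem); silence the linter.
set_option linter.dupNamespace false

namespace TseitinMajSemantics

open Finset Literature.Computability.Complexity Literature.Computability.MetaComplexity

variable {N : ℕ} (G : SimpleGraph (Fin N)) [DecidableRel G.Adj] (c : Fin N → Bool)

/-- **Clause semantics of `τ(G, c) ∘ MAJ₃`**: an assignment satisfying the lifted Tseitin formula
satisfies the lifted parity constraint of every vertex (the clause of `u` indexed by the set of
true star variables of `σ` is falsified by `σ`, so it must be absent, i.e. the constraint holds).
[Urquhart 1987, §4 (the clauses of a vertex express its parity constraint)] -/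
theorem vertexOK_of_eval_tseitinMaj {σ : ℕ → Bool} (hσ : (tseitinMaj G c).eval σ = true)
    (u : Fin N) : vertexOK G c σ u = true := by
  classical
  by_contra hu
  rw [Bool.not_eq_true] at hu
  -- the set of true star variables and the clause it indexes
  set L := liftVars G u with hL
  set T₀ := L.filter (fun i => σ i) with hT₀
  have hmemT₀ : ∀ i ∈ L, (decide (i ∈ T₀)) = σ i := by
    intro i hi
    rw [hT₀]
    by_cases h : σ i = true
    · simp [List.mem_filter, hi, h]
    · simp [List.mem_filter, h]
  have hviol : vertexOK G c (fun i => decide (i ∈ T₀)) u = false := by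
    rw [vertexOK_congr G c u (fun i hi => hmemT₀ i hi)]
    exact hu
  set cl₀ : Clause ℕ := L.map (fun i => (i, decide (i ∉ T₀))) with hcl₀
  have hcl₀mem : cl₀ ∈ tseitinMaj G c := by
    unfold tseitinMaj
    rw [List.mem_flatMap]
    refine ⟨u, List.mem_finRange u, ?_⟩
    unfold tseitinMajVertexClauses
    rw [List.mem_map]
    refine ⟨T₀, ?_, rfl⟩
    rw [List.mem_filter]
    refine ⟨List.mem_sublists.mpr ?_, by simpa using hviol⟩
    rw [hT₀]
    exact List.filter_sublist
  -- `σ` falsifies that clause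
  have hsat : cl₀.any (Literal.eval σ) = true := by
    unfold CNF.eval at hσ
    rw [List.all_eq_true] at hσ
    exact hσ cl₀ hcl₀mem
  rw [List.any_eq_true] at hsat
  obtain ⟨l, hl, hlit⟩ := hsat
  rw [hcl₀, List.mem_map] at hl
  obtain ⟨i, hi, rfl⟩ := hl
  unfold Literal.eval at hlit
  have h1 := hmemT₀ i hi
  revert hlit h1
  cases σ i <;> simp

/-- **Every lifted edge value is counted at both endpoints**: summed over all vertices `u`, the
numbers of neighbours `w` with `edgeVal σ {u, w}` true add up to `0` mod 2 (the counted pairs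
`(u, w)` are swapped without fixed points). [Urquhart 1987, proof of Lemma 4.1] -/
theorem sum_card_filter_edgeVal_eq_zero (σ : ℕ → Bool) :
    (∑ u : Fin N, (((G.neighborFinset u).filter fun w => edgeVal σ s(u, w) = true).card : ZMod 2)) =
      0 := by
  have hrew : ∀ u : Fin N, ((G.neighborFinset u).filter fun w => edgeVal σ s(u, w) = true) =
      Finset.univ.filter (fun w => G.Adj u w ∧ edgeVal σ s(u, w) = true) := by
    intro u
    ext w
    simp [SimpleGraph.mem_neighborFinset]
  simp only [hrew, Finset.natCast_card_filter]
  rw [← Fintype.sum_prod_type']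
  refine Finset.sum_ninvolution Prod.swap ?_ ?_ (fun _ => Finset.mem_univ _) Prod.swap_swap
  · rintro ⟨u, w⟩
    simp only [Prod.fst_swap, Prod.snd_swap]
    by_cases huw : G.Adj u w ∧ edgeVal σ s(u, w) = true
    · rw [if_pos huw, if_pos ⟨huw.1.symm, by rw [Sym2.eq_swap]; exact huw.2⟩]
      decide
    · rw [if_neg huw, if_neg fun h' => huw ⟨h'.1.symm, by rw [Sym2.eq_swap]; exact h'.2⟩,
        add_zero]
  · rintro ⟨u, w⟩ hne heq
    simp only [Prod.swap_prod_mk, Prod.mk.injEq] at heq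
    obtain ⟨rfl, -⟩ := heq
    exact hne (if_neg fun h' => G.irrefl h'.1)

/-- If every lifted parity constraint holds, the number of charged vertices is even. [Urquhart 1987,
Lemma 4.1] -/
theorem even_card_of_forall_vertexOK {σ : ℕ → Bool} (h : ∀ u, vertexOK G c σ u = true) :
    Even (Finset.univ.filter fun u => c u = true).card := by
  have hsum := sum_card_filter_edgeVal_eq_zero G σ
  have hu : ∀ u : Fin N,
      ((((G.neighborFinset u).filter fun w => edgeVal σ s(u, w) = true).card : ℕ) : ZMod 2) =
        if c u = true then 1 else 0 := by
    intro u
    have := h u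
    unfold vertexOK at this
    rw [decide_eq_true_eq] at this
    rw [← ZMod.natCast_mod _ 2, this]
    cases c u <;> simp
  simp only [hu, Finset.sum_boole] at hsum
  exact ZMod.natCast_eq_zero_iff_even.mp hsum

end TseitinMajSemantics

/-- **`τ(G, c) ∘ MAJ₃` is unsatisfiable for odd total charge** — support item `TseitinMajUnsat` of
route PneNP/ReslinMediumCover (stmt-PneNP-19700). [Urquhart 1987, Lemma 4.1; Bhattacharya et al.
2026, Thm 1.2 (the lifted formula)] -/
theorem tseitinMajUnsat_proof : Summit.PneNP.PneNP.Theses.ReslinMediumCover.TseitinMajUnsat := by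
  intro N G _ c hodd hsat
  obtain ⟨σ, hσ⟩ := hsat
  have heven := TseitinMajSemantics.even_card_of_forall_vertexOK G c
    (TseitinMajSemantics.vertexOK_of_eval_tseitinMaj G c hσ)
  exact (Nat.not_even_iff_odd.mpr hodd) heven

end Summit.PneNP.PneNP.Theorems
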